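import Literature.Topology.FourManifolds.LefschetzBaseModel
import HarnessLib

/-!
# The standard Lefschetz base of genus `g`, II: `1/4` is a regular value; the compact base
# `Base g = {rho g ≤ 1/4} ⊂ ℂ²`

Topic `Literature/Topology/FourManifolds`; namespace `Literature.Topology.FourManifolds.LefschetzBase`.
Sequel of `LefschetzBaseModel.lean` (coordinates `cx`, `cy`, the polynomial `Phi g = y² − x^{2g+1}`,
`w = Phi − 1`, the cut-off `eta` and `rho g = ‖w‖² + eta ‖x‖²`).  Everything here is proved;
nothing is asserted.

* §3 **`1/4` is a regular value of `rho g`** (`isRegularLevel_rho`).  At a point `p` of the level: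
  if `w p = 0` then `eta ‖x‖² = 1/4` forces `‖x‖² > 4` and `rho` increases along the radial
  `x`-line (`hasDerivAt_rho_lineX_radial`, `eta' > 0` there); if `w p ≠ 0 ≠ y` it increases along
  the `y`-line with velocity `w ȳ` (`hasDerivAt_rho_lineY`, derivative `4‖y‖²‖w‖²`); if
  `w p ≠ 0 = y` then `‖x‖ < 2` (`norm_sq_cx_lt_four_of_cy_eq_zero`), `eta ≡ 0` near `p`, and it
  increases along the `x`-line with velocity `−conj(w̄ x^{2g})` (`hasDerivAt_rho_lineX`, derivative
  `2(2g+1)‖w̄ x^{2g}‖²`, non-zero as `x ≠ 0` since `rho 0 = 1`).  Directional derivatives are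
  computed as derivatives of one-variable polynomials (`hasDerivAt_norm_sq_comp`) and compared
  with the Fréchet derivative along lines (`not_isMCriticalPt_of_hasDerivAt_line`).
* §4 **the base** `Base g := RegularSublevel (isRegularLevel_rho g)` — a smooth 4-manifold with
  boundary modelled on `𝓡∂ 4` (`RegularLevelSplitting.lean`), compact (`compactSpace_base`:
  `‖x‖² < 6`, `‖w‖ ≤ 1/2`, hence `‖p‖² ≤ 8 + 3^{4g+2}` on `{rho ≤ 1/4}`), with boundary datum
  `bBase g`; `rho g 0 = 1` (the polynomial `Phi g` has no critical point in the base) and the part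
  `‖x‖ ≤ 2` of the central page lies in `{rho = 0}`.

On paper `Base g ≅ F_{g,1} × D² ≅ ♮^{2g} S¹ × B³` (Ehresmann + corner flow; Gompf–Stipsicz 1999,
§4.6 and §8.2; Etnyre–Fuller 2006, §2); this identification is documentation for the named facts
over the Lefschetz-handlebody vocabulary and is not used formally.

## References
* R. E. Gompf, A. I. Stipsicz, *4-Manifolds and Kirby Calculus*, GSM 20 (1999), §8.2.
* J. B. Etnyre, T. Fuller, *Realizing 4-manifolds as achiral Lefschetz fibrations*, IMRN 2006,
  §2. [EtnyreFuller2006]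
-/

noncomputable section

open scoped Manifold ContDiff Topology ComplexConjugate
open Set Function Metric

namespace Literature.Topology.FourManifolds

/-- Local notation: `𝔼 n` is the model Euclidean space `EuclideanSpace ℝ (Fin n)`. -/
local notation "𝔼 " n:arg => EuclideanSpace ℝ (Fin n)

namespace LefschetzBase

/-! ## §3 `1/4` is a regular value of `rho g` -/

/-- `t ↦ (t : ℂ)` has derivative `1`. [folklore] -/
theorem hasDerivAt_ofReal' (t : ℝ) : HasDerivAt (fun s : ℝ => (s : ℂ)) 1 t := by
  have h := (hasDerivAt_id' t).ofReal_comp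
  rw [Complex.ofReal_one] at h
  exact h

/-- Derivative of `‖q‖²` for a complex-valued function of a real variable. [folklore] -/
theorem hasDerivAt_norm_sq_comp {q : ℝ → ℂ} {q' : ℂ} {t : ℝ} (hq : HasDerivAt q q' t) :
    HasDerivAt (fun s => ‖q s‖ ^ 2) (2 * (conj (q t) * q').re) t := by
  have hre : HasDerivAt (fun s => (q s).re) q'.re t :=
    Complex.reCLM.hasFDerivAt.comp_hasDerivAt t hq
  have him : HasDerivAt (fun s => (q s).im) q'.im t :=
    Complex.imCLM.hasFDerivAt.comp_hasDerivAt t hq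
  have h := (hre.mul hre).add (him.mul him)
  have hfun : (fun s => ‖q s‖ ^ 2) = fun s => (q s).re * (q s).re + (q s).im * (q s).im := by
    funext s; rw [Complex.sq_norm, Complex.normSq_apply]
  rw [hfun]
  refine h.congr_deriv ?_
  simp only [Complex.mul_re, Complex.conj_re, Complex.conj_im]
  ring

/-- The derivative of a function along the line `t ↦ p + t v` is its Fréchet derivative applied to
`v`. [folklore] -/
theorem hasDerivAt_comp_line {f : 𝔼 4 → ℝ} (hf : Differentiable ℝ f) (p v : 𝔼 4) :
    HasDerivAt (fun t : ℝ => f (p + t • v)) (fderiv ℝ f p v) 0 := by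
  have hl : HasDerivAt (fun t : ℝ => p + t • v) v 0 := by
    have h := ((hasDerivAt_id (0 : ℝ)).smul_const v).const_add p
    rw [one_smul] at h
    exact h
  have h := (hf (p + (0 : ℝ) • v)).hasFDerivAt.comp_hasDerivAt (0 : ℝ) hl
  rw [zero_smul, add_zero] at h
  exact h

/-- On a vector space, a function with non-zero derivative along some line through `p` is not
critical at `p`. [folklore] -/
theorem not_isMCriticalPt_of_hasDerivAt_line {f : 𝔼 4 → ℝ} (hf : Differentiable ℝ f)
    {p v : 𝔼 4} {d : ℝ} (hline : HasDerivAt (fun t : ℝ => f (p + t • v)) d 0) (hd : d ≠ 0) :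
    ¬ IsMCriticalPt (𝓡 4) f p := by
  simp only [IsMCriticalPt, mfderiv_eq_fderiv]
  intro h0
  have h1 := hasDerivAt_comp_line hf p v
  have h2 : fderiv ℝ f p v = d := h1.unique hline
  have h3 : fderiv ℝ f p v = 0 :=
    (congrArg (fun L : TangentSpace (𝓡 4) p →L[ℝ] TangentSpace 𝓘(ℝ, ℝ) (f p) => L v) h0).trans rfl
  exact hd (h2.symm.trans h3)

/-- `w` along the `y`-line: `w(p + t(0,c)) = w p + t (2 c y) + t² c²`. [folklore] -/
theorem w_lineY (g : ℕ) (p : 𝔼 4) (c : ℂ) (t : ℝ) :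
    w g (lineY p c t) = w g p + (t : ℂ) * (2 * c * cy p) + (t : ℂ) ^ 2 * c ^ 2 := by
  simp only [w, Phi, cx_lineY, cy_lineY]
  ring

/-- `w` along the `x`-line: `w(p + t(u,0)) = y² − (x + t u)^{2g+1} − 1`. [folklore] -/
theorem w_lineX (g : ℕ) (p : 𝔼 4) (u : ℂ) (t : ℝ) :
    w g (lineX p u t) = cy p ^ 2 - (cx p + (t : ℂ) * u) ^ (2 * g + 1) - 1 := by
  simp only [w, Phi, cx_lineX, cy_lineX]

/-- Derivative of `w` along the `y`-line at `t = 0`: `2 c y`. [folklore] -/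
theorem hasDerivAt_w_lineY (g : ℕ) (p : 𝔼 4) (c : ℂ) :
    HasDerivAt (fun t => w g (lineY p c t)) (2 * c * cy p) 0 := by
  have h1 := ((hasDerivAt_ofReal' 0).mul_const (2 * c * cy p)).const_add (w g p)
  have h2 := ((hasDerivAt_ofReal' 0).pow 2).mul_const (c ^ 2)
  have h := h1.add h2
  have hfun : (fun t => w g (lineY p c t)) =
      fun t : ℝ => w g p + (t : ℂ) * (2 * c * cy p) + (t : ℂ) ^ 2 * c ^ 2 :=
    funext (w_lineY g p c)
  rw [hfun]
  refine h.congr_deriv ?_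
  simp

/-- Derivative of `w` along the `x`-line at `t = 0`: `−(2g+1) x^{2g} u`. [folklore] -/
theorem hasDerivAt_w_lineX (g : ℕ) (p : 𝔼 4) (u : ℂ) :
    HasDerivAt (fun t => w g (lineX p u t)) (-((2 * g + 1 : ℕ) * cx p ^ (2 * g) * u)) 0 := by
  have h1 : HasDerivAt (fun t : ℝ => (cx p + (t : ℂ) * u) ^ (2 * g + 1))
      ((2 * g + 1 : ℕ) * (cx p + ((0 : ℝ) : ℂ) * u) ^ (2 * g + 1 - 1) * (1 * u)) 0 :=
    (((hasDerivAt_ofReal' 0).mul_const u).const_add (cx p)).pow (2 * g + 1)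
  have h2 := (h1.const_sub (cy p ^ 2)).sub_const 1
  have hfun : (fun t => w g (lineX p u t)) =
      fun t : ℝ => cy p ^ 2 - (cx p + (t : ℂ) * u) ^ (2 * g + 1) - 1 :=
    funext (w_lineX g p u)
  rw [hfun]
  refine h2.congr_deriv ?_
  simp

/-- `‖x‖²` along the `x`-line. [folklore] -/
theorem hasDerivAt_norm_sq_cx_lineX (p : 𝔼 4) (u : ℂ) :
    HasDerivAt (fun t => ‖cx (lineX p u t)‖ ^ 2) (2 * (conj (cx p) * u).re) 0 := by
  have h : HasDerivAt (fun t : ℝ => cx p + (t : ℂ) * u) (1 * u) 0 :=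
    ((hasDerivAt_ofReal' 0).mul_const u).const_add (cx p)
  have h' := hasDerivAt_norm_sq_comp h
  have hfun : (fun t => ‖cx (lineX p u t)‖ ^ 2) = fun t : ℝ => ‖cx p + (t : ℂ) * u‖ ^ 2 := by
    funext t; rw [cx_lineX]
  rw [hfun]
  refine h'.congr_deriv ?_
  simp

/-- `eta` has derivative `0` inside the flat region. [folklore] -/
theorem hasDerivAt_eta_of_lt {s : ℝ} (hs : s < 4) : HasDerivAt eta 0 s := by
  refine (hasDerivAt_const s (0 : ℝ)).congr_of_eventuallyEq ?_
  filter_upwards [gt_mem_nhds hs] with u hu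
  exact eta_of_le hu.le

/-- `conj z * z = ‖z‖²` read in `ℝ`. [folklore] -/
theorem re_conj_mul_self (z : ℂ) : (conj z * z).re = ‖z‖ ^ 2 := by
  rw [Complex.conj_mul', ← Complex.ofReal_pow, Complex.ofReal_re]

/-- **Variation in `y`**: `rho` has derivative `4 ‖y‖² ‖w‖²` along the `y`-line with velocity
`c = w ȳ`. [folklore] -/
theorem hasDerivAt_rho_lineY (g : ℕ) (p : 𝔼 4) :
    HasDerivAt (fun t => rho g (lineY p (w g p * conj (cy p)) t))
      (4 * ‖cy p‖ ^ 2 * ‖w g p‖ ^ 2) 0 := by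
  have h1 := hasDerivAt_norm_sq_comp (hasDerivAt_w_lineY g p (w g p * conj (cy p)))
  have h2 : HasDerivAt (fun t : ℝ => eta (‖cx (lineY p (w g p * conj (cy p)) t)‖ ^ 2)) 0 0 := by
    have hfun : (fun t : ℝ => eta (‖cx (lineY p (w g p * conj (cy p)) t)‖ ^ 2)) =
        fun _ => eta (‖cx p‖ ^ 2) := by
      funext t; rw [cx_lineY]
    rw [hfun]
    exact hasDerivAt_const _ _
  have h := h1.add h2
  rw [lineY_zero] at h
  refine h.congr_deriv ?_
  have key : conj (w g p) * (2 * (w g p * conj (cy p)) * cy p) =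
      2 * (conj (w g p) * w g p) * (conj (cy p) * cy p) := by ring
  rw [add_zero, key]
  have e : (2 * (conj (w g p) * w g p) * (conj (cy p) * cy p)).re = 2 * ‖w g p‖ ^ 2 * ‖cy p‖ ^ 2 := by
    rw [Complex.conj_mul', Complex.conj_mul']
    norm_cast
  rw [e]
  ring

/-- **Radial variation in `x` on the central page**: at a point with `w = 0` and `‖x‖² > 4`,
`rho` has derivative `eta'(‖x‖²) · 2‖x‖²` along the radial `x`-line. [folklore] -/
theorem hasDerivAt_rho_lineX_radial (g : ℕ) (p : 𝔼 4) (hw : w g p = 0) (hx : 4 < ‖cx p‖ ^ 2) :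
    HasDerivAt (fun t => rho g (lineX p (cx p) t))
      (deriv eta (‖cx p‖ ^ 2) * (2 * ‖cx p‖ ^ 2)) 0 := by
  have h1 := hasDerivAt_norm_sq_comp (hasDerivAt_w_lineX g p (cx p))
  rw [lineX_zero, hw, map_zero, zero_mul, Complex.zero_re, mul_zero] at h1
  have hin := hasDerivAt_norm_sq_cx_lineX p (cx p)
  have hout : HasDerivAt eta (deriv eta (‖cx (lineX p (cx p) 0)‖ ^ 2))
      (‖cx (lineX p (cx p) 0)‖ ^ 2) := by
    rw [lineX_zero]
    exact (hasDerivAt_eta hx).differentiableAt.hasDerivAt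
  have h2 := hout.comp 0 hin
  rw [lineX_zero] at h2
  have h := h1.add h2
  refine h.congr_deriv ?_
  rw [re_conj_mul_self, zero_add]

/-- **Variation in `x` off the central page with `y = 0`**: at a point with `‖x‖² < 4`, `rho` has
derivative `2(2g+1) ‖w̄ x^{2g}‖²` along the `x`-line with velocity `u = −conj(w̄ x^{2g})`.
[folklore] -/
theorem hasDerivAt_rho_lineX (g : ℕ) (p : 𝔼 4) (hx : ‖cx p‖ ^ 2 < 4) :
    HasDerivAt (fun t => rho g (lineX p (-(conj (conj (w g p) * cx p ^ (2 * g)))) t))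
      (2 * ((2 * g + 1 : ℕ) * ‖conj (w g p) * cx p ^ (2 * g)‖ ^ 2)) 0 := by
  set A : ℂ := conj (w g p) * cx p ^ (2 * g) with hA
  have h1 := hasDerivAt_norm_sq_comp (hasDerivAt_w_lineX g p (-(conj A)))
  rw [lineX_zero] at h1
  have hin := hasDerivAt_norm_sq_cx_lineX p (-(conj A))
  have hout : HasDerivAt eta 0 (‖cx (lineX p (-(conj A)) 0)‖ ^ 2) := by
    rw [lineX_zero]
    exact hasDerivAt_eta_of_lt hx
  have h2 := hout.comp 0 hin
  rw [zero_mul] at h2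
  have h := h1.add h2
  refine h.congr_deriv ?_
  rw [add_zero]
  have key : conj (w g p) * -((2 * g + 1 : ℕ) * cx p ^ (2 * g) * -(conj A)) =
      (2 * g + 1 : ℕ) * (conj A * A) := by
    rw [hA]; ring
  rw [key]
  have e : (((2 * g + 1 : ℕ) : ℂ) * (conj A * A)).re = (2 * g + 1 : ℕ) * ‖A‖ ^ 2 := by
    rw [Complex.conj_mul']
    norm_cast
  rw [e]

/-- If `y = 0` at a point of the level `rho = 1/4`, then `‖x‖ < 2` (otherwise
`‖x^{2g+1} + 1‖ ≥ 1`). [folklore] -/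
theorem norm_sq_cx_lt_four_of_cy_eq_zero (g : ℕ) {p : 𝔼 4} (hρ : rho g p = 1 / 4)
    (hy : cy p = 0) : ‖cx p‖ ^ 2 < 4 := by
  by_contra h
  rw [not_lt] at h
  have hx1 : 1 ≤ ‖cx p‖ := by nlinarith [norm_nonneg (cx p)]
  have hx2 : 2 ≤ ‖cx p‖ := by nlinarith [norm_nonneg (cx p)]
  have hpow : ‖cx p‖ ≤ ‖cx p‖ ^ (2 * g + 1) := by
    calc ‖cx p‖ = ‖cx p‖ ^ 1 := (pow_one _).symm
      _ ≤ ‖cx p‖ ^ (2 * g + 1) := pow_le_pow_right₀ hx1 (by omega)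
  have hw : 1 ≤ ‖w g p‖ := by
    have : w g p = -(cx p ^ (2 * g + 1) + 1) := by simp [w, Phi, hy]; ring
    rw [this, norm_neg]
    have h3 : ‖cx p ^ (2 * g + 1)‖ ≤ ‖cx p ^ (2 * g + 1) + 1‖ + ‖(1 : ℂ)‖ := by
      have := norm_sub_le (cx p ^ (2 * g + 1) + 1) 1
      rwa [add_sub_cancel_right] at this
    rw [norm_pow, norm_one] at h3
    linarith
  have : 1 ≤ rho g p := by
    unfold rho
    nlinarith [eta_nonneg (‖cx p‖ ^ 2)]
  linarith

/-- `cx 0 = 0`. [folklore] -/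
@[simp] theorem cx_zero : cx 0 = 0 := by
  apply Complex.ext <;> simp [cx]

/-- `mk 0 0 = 0`. [folklore] -/
@[simp] theorem mk_zero : mk 0 0 = 0 := by
  ext i; fin_cases i <;> simp [mk]

/-- `cy 0 = 0`. [folklore] -/
@[simp] theorem cy_zero : cy 0 = 0 := by
  apply Complex.ext <;> simp [cy]

/-- **`1/4` is a regular value of `rho g`.** [folklore] -/
theorem isRegularLevel_rho (g : ℕ) : IsRegularLevel (𝓡 4) (rho g) (1 / 4) := by
  refine isRegularLevel_of_not_isMCriticalPt (k := 3) (contMDiff_iff_contDiff.2 (contDiff_rho g)) ?_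
  intro p hp
  have hdiff : Differentiable ℝ (rho g) := (contDiff_rho g).differentiable (by simp)
  by_cases hw : w g p = 0
  · -- on the central page: `eta ‖x‖² = 1/4`, so `‖x‖² > 4`; radial `x`-variation
    have heta : eta (‖cx p‖ ^ 2) = 1 / 4 := by
      have : rho g p = eta (‖cx p‖ ^ 2) := by simp [rho, hw]
      rw [← this, hp]
    have hx : 4 < ‖cx p‖ ^ 2 := by
      by_contra h
      rw [eta_of_le (not_lt.1 h)] at heta
      norm_num at heta
    refine not_isMCriticalPt_of_hasDerivAt_line hdiff (hasDerivAt_rho_lineX_radial g p hw hx) ?_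
    exact (mul_pos (deriv_eta_pos hx) (by positivity)).ne'
  · by_cases hy : cy p = 0
    · -- `y = 0 ≠ w`: then `‖x‖ < 2` and the `x`-variation sees `(2g+1) x^{2g}`
      have hx : ‖cx p‖ ^ 2 < 4 := norm_sq_cx_lt_four_of_cy_eq_zero g hp hy
      have hx0 : cx p ≠ 0 := by
        intro h0
        have h1 : rho g p = 1 := by
          have : p = 0 := by rw [← mk_cx_cy p, hy, h0, mk_zero]
          rw [this]
          simp [rho, w, Phi, eta_of_le]
        rw [hp] at h1
        norm_num at h1
      refine not_isMCriticalPt_of_hasDerivAt_line hdiff (hasDerivAt_rho_lineX g p hx) ?_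
      have hA : conj (w g p) * cx p ^ (2 * g) ≠ 0 :=
        mul_ne_zero ((map_ne_zero _).2 hw) (pow_ne_zero _ hx0)
      have : 0 < ‖conj (w g p) * cx p ^ (2 * g)‖ := norm_pos_iff.2 hA
      positivity
    · -- `w ≠ 0 ≠ y`: the `y`-variation
      refine not_isMCriticalPt_of_hasDerivAt_line hdiff (hasDerivAt_rho_lineY g p) ?_
      have h1 : 0 < ‖cy p‖ := norm_pos_iff.2 hy
      have h2 : 0 < ‖w g p‖ := norm_pos_iff.2 hw
      positivity

/-! ## §4 The base `Base g = {rho g ≤ 1/4}` -/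

/-- **The standard Lefschetz base of genus `g`**: the compact smooth 4-manifold with boundary
`{rho g ≤ 1/4} ⊂ ℂ²`, a rounded tube around the part of the Milnor fibre `y² = x^{2g+1} + 1`
over the disc `|x| ≲ 2.4`; on paper `F_{g,1} × D² ≅ ♮^{2g} S¹ × B³`. [cite: EtnyreFuller2006, §2] -/
abbrev Base (g : ℕ) : Type := RegularSublevel (isRegularLevel_rho g)

/-- The boundary datum of the base (its boundary 3-manifold `{rho g = 1/4}` with its inclusion).
[folklore] -/
abbrev bBase (g : ℕ) : BoundaryData (𝓡∂ 4) (Base g) (𝓡 3) :=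
  RegularSublevel.boundaryData (isRegularLevel_rho g)

/-- A priori bounds on `{rho g ≤ 1/4}`: `‖x‖² < 6` and `‖w‖² ≤ 1/4`. [folklore] -/
theorem bounds_of_rho_le (g : ℕ) {p : 𝔼 4} (hp : rho g p ≤ 1 / 4) :
    ‖cx p‖ ^ 2 < 6 ∧ ‖w g p‖ ^ 2 ≤ 1 / 4 := by
  have h1 : ‖w g p‖ ^ 2 ≤ 1 / 4 := by
    unfold rho at hp; nlinarith [eta_nonneg (‖cx p‖ ^ 2)]
  refine ⟨?_, h1⟩
  by_contra h
  rw [not_lt] at h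
  have : (1 / 2 : ℝ) ≤ eta (‖cx p‖ ^ 2) := half_le_eta_six.trans (eta_monotone h)
  unfold rho at hp
  nlinarith [sq_nonneg ‖w g p‖]

/-- `{rho g ≤ 1/4}` is bounded: `‖p‖² ≤ 8 + 3^{4g+2}`. [folklore] -/
theorem norm_sq_le_of_rho_le (g : ℕ) {p : 𝔼 4} (hp : rho g p ≤ 1 / 4) :
    ‖p‖ ^ 2 ≤ 8 + (3 : ℝ) ^ (4 * g + 2) := by
  obtain ⟨hx, hw⟩ := bounds_of_rho_le g hp
  have hx3 : ‖cx p‖ ≤ 3 := by nlinarith [norm_nonneg (cx p)]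
  have hwn : ‖w g p‖ ≤ 1 := by nlinarith [norm_nonneg (w g p)]
  have hy : cy p ^ 2 = w g p + 1 + cx p ^ (2 * g + 1) := by
    simp only [w, Phi]; ring
  have hxn : ‖cx p ^ (2 * g + 1)‖ ≤ (3 : ℝ) ^ (2 * g + 1) := by
    rw [norm_pow]
    exact pow_le_pow_left₀ (norm_nonneg _) hx3 _
  have hy2 : ‖cy p‖ ^ 2 ≤ 2 + (3 : ℝ) ^ (2 * g + 1) := by
    rw [← norm_pow, hy]
    have := norm_add₃_le (a := w g p) (b := (1 : ℂ)) (c := cx p ^ (2 * g + 1))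
    rw [norm_one] at this
    linarith
  have h3 : (3 : ℝ) ^ (2 * g + 1) ≤ 3 ^ (4 * g + 2) :=
    pow_le_pow_right₀ (by norm_num) (by omega)
  rw [norm_sq_eq]
  linarith

/-- `{rho g ≤ 1/4}` is compact (closed and bounded in `ℝ⁴`). [folklore] -/
theorem isCompact_rho_le (g : ℕ) : IsCompact (rho g ⁻¹' Iic (1 / 4)) := by
  refine Metric.isCompact_of_isClosed_isBounded
    (isClosed_Iic.preimage (contDiff_rho g).continuous) ?_
  rw [isBounded_iff_forall_norm_le]
  refine ⟨8 + (3 : ℝ) ^ (4 * g + 2), fun p hp => ?_⟩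
  have h := norm_sq_le_of_rho_le g hp
  have h0 : (0 : ℝ) ≤ 3 ^ (4 * g + 2) := by positivity
  nlinarith [norm_nonneg p]

/-- **The base is compact.** [folklore] -/
instance compactSpace_base (g : ℕ) : CompactSpace (Base g) :=
  isCompact_iff_compactSpace.1 (isCompact_rho_le g)

/-- The origin of `ℂ²` does not lie in the base (`rho g 0 = 1`); in particular `Phi g` has no
critical point in `Base g`. [folklore] -/
theorem rho_zero (g : ℕ) : rho g 0 = 1 := by
  simp [rho, w, Phi, eta_of_le]

/-- Points of the central page `y² = x^{2g+1} + 1` with `‖x‖ ≤ 2` lie in the base (indeed in its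
interior: `rho = 0` there). [folklore] -/
theorem rho_eq_zero_of_w_eq_zero (g : ℕ) {p : 𝔼 4} (hw : w g p = 0) (hx : ‖cx p‖ ^ 2 ≤ 4) :
    rho g p = 0 := by
  simp [rho, hw, eta_of_le hx]

end LefschetzBase

end Literature.Topology.FourManifolds
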